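import Summits.RiemannHypothesis.RiemannHypothesis.Theorems.HandoffSemilocalParitySplit
import Summits.RiemannHypothesis.RiemannHypothesis.Theorems.SemilocalDeletionDipole
import HarnessLib

/-!
# The TWO-LEVEL RITZ CEILING for semi-local ground energies (upper half of the two-level law of the compression defect)

Companion of `SemilocalDeletionCompression` (the FLOOR half: `Re Q_S(v + w) ≥ λ₋(m₁, m₂, β)‖v + w‖₂²` for two `L²`-orthogonal
blocks with floors `m₁, m₂` and coupling `β`).  Here the CEILING: if two `L²`-orthogonal admissible test functions `v`, `w` have
Rayleigh quotients AT MOST `m₁`, `m₂` and a cross form `Re C_S(v, w) ≤ −2β‖v‖₂‖w‖₂` (`β ≥ 0`; flip the sign of `w` to arrange it),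
then some nonnegative combination `a v + b w` has quotient at most

  `λ₋(m₁, m₂, β) = (m₁ + m₂)/2 − √(((m₂ − m₁)/2)² + β²)`  (the lower eigenvalue of `[[m₁, β], [β, m₂]]`, written out in full below),

so `λ_min(S; c; P) ≤ λ₋(m₁, m₂, β) ≤ m₁ − β²/(m₂ − m₁ + β²/(m₂ − m₁))` (`m₂ > m₁`): a two-level Ritz bound that IMPROVES the one-function
Ritz ceiling `λ_min ≤ m₁` by almost `β²/(m₂ − m₁)`.

Why (numerics of the `rh-explicit` cell, seat cc-s2-1 gen15, EXPLORATORY kit j224368 on the 56 deleted cells of gen14's compression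
files at `b = 2, 47/20, 3`, `N = 400`): with `v = v₀` the bottom vector of the deleted form COMPRESSED to the `2ν` near-null directions of
the window form (`m₁ = π`), `w = ẑ` the direction of its residual (`β = r = ‖residual‖`, `m₂ = κ = ẑᵀG_del ẑ = 2.9…8.8`), the certified
compression defect obeys the TWO-LEVEL LAW `π − ε₁ = ρ·(π − λ₋(π, κ, r))`, `ρ ∈ [1.008, 1.242]` over 13 orders of magnitude — the lower
end `ρ ≥ 1` is THIS FILE'S THEOREM (`π − λ_min ≥ π − λ₋(π, κ, r) ≥ r²/(κ − π + r²/(κ − π))`), the upper end `ρ ≲ 1.25` is DATA (sealed blind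
test PREREG-ccs21-g15-twolevel on 72 new cells).  §4 applies the ceiling to the antisymmetric DIPOLE of `SemilocalDeletionDipole`: the
cliff offset `Δ = λ_min(S∖{p}; (log p)/2 + δ) + log p/√p` is at most `λ₋(D, K, β) < D` as soon as the dipole couples (`β > 0`) to an
orthogonal test function of quotient `K` — a strict sharpening of the dipole ceiling `Δ ≤ D`.

Statements about truncated Weil forms only (Rayleigh-quotient algebra); nothing here bears on RH.  `λ₋` is written OUT IN FULL in every
statement (no definition, no notation).
-/

set_option linter.dupNamespace false

noncomputable section

open Complex Filter Set MeasureTheory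
open scoped Real Topology ComplexConjugate

namespace Summit.RiemannHypothesis.RiemannHypothesis.Theorems.SemilocalDeletionCompressionCeiling

open Literature.NumberTheory.LFunctions
open Summit.RiemannHypothesis.RiemannHypothesis.Theorems.HandoffSemilocalEnergy
open Summit.RiemannHypothesis.RiemannHypothesis.Theorems.HandoffSemilocalParitySplit
open Summit.RiemannHypothesis.RiemannHypothesis.Theorems.SemilocalDeletionDipole

/-! ## §1  Two facts about `λ₋(m₁, m₂, β)` (the floor-side facts live in `SemilocalDeletionCompression`) -/

variable {m₁ m₂ β : ℝ}

/-- **The bottom eigenvector evaluates to `λ₋`**: with `l = λ₋(m₁, m₂, β)` and `(a, b) = (m₂ − l, β)`,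
`m₁a² − 2βab + m₂b² = l·(a² + b²)`. -/
theorem twoLevel_value_eq (m₁ m₂ β : ℝ) :
    m₁ * (m₂ - ((m₁ + m₂) / 2 - Real.sqrt (((m₂ - m₁) / 2) ^ 2 + β ^ 2))) ^ 2
        - 2 * β * (m₂ - ((m₁ + m₂) / 2 - Real.sqrt (((m₂ - m₁) / 2) ^ 2 + β ^ 2))) * β + m₂ * β ^ 2 =
      ((m₁ + m₂) / 2 - Real.sqrt (((m₂ - m₁) / 2) ^ 2 + β ^ 2)) *
        ((m₂ - ((m₁ + m₂) / 2 - Real.sqrt (((m₂ - m₁) / 2) ^ 2 + β ^ 2))) ^ 2 + β ^ 2) := by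
  set s := Real.sqrt (((m₂ - m₁) / 2) ^ 2 + β ^ 2) with hs
  have hs2 : s ^ 2 = ((m₂ - m₁) / 2) ^ 2 + β ^ 2 := Real.sq_sqrt (by positivity)
  -- characteristic equation `(m₁ − l)(m₂ − l) = β²`, then expand
  have hchar : (m₁ - ((m₁ + m₂) / 2 - s)) * (m₂ - ((m₁ + m₂) / 2 - s)) = β ^ 2 := by linear_combination hs2
  linear_combination (m₂ - ((m₁ + m₂) / 2 - s)) * hchar

/-- **The explicit form of the two-level gain**: for `m₂ > m₁`,
`λ₋(m₁, m₂, β) ≤ m₁ − β²/(m₂ − m₁ + β²/(m₂ − m₁))` — the two-level value undercuts `m₁` by almost `β²/(m₂ − m₁)`. -/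
theorem twoLevel_le_sub_div (h : m₁ < m₂) (β : ℝ) :
    ((m₁ + m₂) / 2 - Real.sqrt (((m₂ - m₁) / 2) ^ 2 + β ^ 2)) ≤ m₁ - β ^ 2 / (m₂ - m₁ + β ^ 2 / (m₂ - m₁)) := by
  set s := Real.sqrt (((m₂ - m₁) / 2) ^ 2 + β ^ 2) with hs
  set l := (m₁ + m₂) / 2 - s with hl
  have hs2 : s ^ 2 = ((m₂ - m₁) / 2) ^ 2 + β ^ 2 := Real.sq_sqrt (by positivity)
  have hd : 0 < m₂ - m₁ := sub_pos.2 h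
  have hchar : (m₁ - l) * (m₂ - l) = β ^ 2 := by rw [hl]; linear_combination hs2
  -- `m₁ − l ≥ 0` and `l ≥ m₁ − β²/(m₂ − m₁)` (the floor side), hence `0 < m₂ − l ≤ m₂ − m₁ + β²/(m₂ − m₁)`
  have h1 : 0 ≤ m₁ - l := by
    have hle : |(m₂ - m₁) / 2| ≤ s := Real.abs_le_sqrt (by nlinarith [sq_nonneg β])
    have := le_abs_self ((m₂ - m₁) / 2)
    rw [hl]; linarith
  have hR : 0 ≤ (m₂ - m₁) / 2 + β ^ 2 / (m₂ - m₁) := by positivity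
  have hsq : ((m₂ - m₁) / 2 + β ^ 2 / (m₂ - m₁)) ^ 2 = ((m₂ - m₁) / 2) ^ 2 + β ^ 2 + (β ^ 2 / (m₂ - m₁)) ^ 2 := by
    field_simp
    ring
  have hsle : s ≤ (m₂ - m₁) / 2 + β ^ 2 / (m₂ - m₁) := by
    calc s = Real.sqrt (((m₂ - m₁) / 2) ^ 2 + β ^ 2) := hs
      _ ≤ Real.sqrt (((m₂ - m₁) / 2 + β ^ 2 / (m₂ - m₁)) ^ 2) :=
          Real.sqrt_le_sqrt (by rw [hsq]; nlinarith [sq_nonneg (β ^ 2 / (m₂ - m₁))])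
      _ = (m₂ - m₁) / 2 + β ^ 2 / (m₂ - m₁) := Real.sqrt_sq hR
  have h2 : m₂ - l ≤ m₂ - m₁ + β ^ 2 / (m₂ - m₁) := by rw [hl]; linarith
  have h2pos : 0 < m₂ - l := by linarith
  have hD : 0 < m₂ - m₁ + β ^ 2 / (m₂ - m₁) := by positivity
  -- `m₁ − l = β²/(m₂ − l) ≥ β²/(m₂ − m₁ + β²/(m₂ − m₁))`
  have hkey : β ^ 2 / (m₂ - m₁ + β ^ 2 / (m₂ - m₁)) ≤ m₁ - l := by
    rw [div_le_iff₀ hD]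
    calc β ^ 2 = (m₁ - l) * (m₂ - l) := hchar.symm
      _ ≤ (m₁ - l) * (m₂ - m₁ + β ^ 2 / (m₂ - m₁)) := mul_le_mul_of_nonneg_left h2 h1
  linarith

/-! ## §2  Real scalings of the form, the cross form and the `L²` pairing -/

variable {S : Finset ℕ} {v w g : ℝ → ℂ} {P : (ℝ → ℂ) → Prop} {c : ℝ}

/-- `Re Q_S(a·v) = a²·Re Q_S(v)` for real `a`. -/
theorem re_weilSemilocalQuadratic_ofReal_mul (S : Finset ℕ) (a : ℝ) (v : ℝ → ℂ) :
    (weilSemilocalQuadratic S (fun t ↦ (a : ℂ) * v t)).re = a ^ 2 * (weilSemilocalQuadratic S v).re := by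
  rw [weilSemilocalQuadratic_const_mul, Complex.normSq_ofReal, Complex.re_ofReal_mul, sq]

/-- The cross form scales bilinearly under real scalars: `C_S(a·v, b·w) = ab·C_S(v, w)`. -/
theorem weilSemilocalCross_ofReal_mul (S : Finset ℕ) (a b : ℝ) (v w : ℝ → ℂ) :
    weilSemilocalFunctional S (weilConv (fun t ↦ (a : ℂ) * v t) (weilReflect fun t ↦ (b : ℂ) * w t)) +
        weilSemilocalFunctional S (weilConv (fun t ↦ (b : ℂ) * w t) (weilReflect fun t ↦ (a : ℂ) * v t)) =
      ((a * b : ℝ) : ℂ) * (weilSemilocalFunctional S (weilConv v (weilReflect w)) +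
        weilSemilocalFunctional S (weilConv w (weilReflect v))) := by
  rw [weilReflect_const_mul, weilReflect_const_mul, weilConv_const_mul_left, weilConv_const_mul_left]
  have e1 : (fun t ↦ (a : ℂ) * weilConv v (fun t ↦ conj (b : ℂ) * weilReflect w t) t) =
      fun t ↦ ((a * b : ℝ) : ℂ) * weilConv v (weilReflect w) t := by
    funext t
    rw [weilConv_const_mul_right, Complex.conj_ofReal, Complex.ofReal_mul]
    ring
  have e2 : (fun t ↦ (b : ℂ) * weilConv w (fun t ↦ conj (a : ℂ) * weilReflect v t) t) =
      fun t ↦ ((a * b : ℝ) : ℂ) * weilConv w (weilReflect v) t := by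
    funext t
    rw [weilConv_const_mul_right, Complex.conj_ofReal, Complex.ofReal_mul]
    ring
  rw [e1, e2, weilSemilocalFunctional_const_mul, weilSemilocalFunctional_const_mul]
  ring

/-- `⟨a·v, b·w⟩ = ab⟨v, w⟩` for real `a, b`. -/
theorem integral_ofReal_mul_mul_conj (a b : ℝ) (v w : ℝ → ℂ) :
    ∫ t, (a : ℂ) * v t * conj ((b : ℂ) * w t) = ((a * b : ℝ) : ℂ) * ∫ t, v t * conj (w t) := by
  rw [← integral_const_mul]
  congr 1 with t
  rw [map_mul, Complex.conj_ofReal, Complex.ofReal_mul]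
  ring

/-- `Re Q_S` of a real combination: `Re Q_S(a v + b w) = a²Re Q_S(v) + b²Re Q_S(w) + ab·Re C_S(v, w)`. -/
theorem re_weilSemilocalQuadratic_combo (S : Finset ℕ) (hv : IsWeilTest v) (hw : IsWeilTest w) (a b : ℝ) :
    (weilSemilocalQuadratic S (fun t ↦ (a : ℂ) * v t + (b : ℂ) * w t)).re =
      a ^ 2 * (weilSemilocalQuadratic S v).re + b ^ 2 * (weilSemilocalQuadratic S w).re +
        a * b * (weilSemilocalFunctional S (weilConv v (weilReflect w)) +
          weilSemilocalFunctional S (weilConv w (weilReflect v))).re := by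
  have hsum : (fun t ↦ (a : ℂ) * v t + (b : ℂ) * w t) = (fun t ↦ (a : ℂ) * v t) + fun t ↦ (b : ℂ) * w t := rfl
  have h := congrArg Complex.re (weilSemilocalQuadratic_add S (hv.const_mul a) (hw.const_mul b))
  rw [hsum, h, Complex.add_re, Complex.add_re, re_weilSemilocalQuadratic_ofReal_mul, re_weilSemilocalQuadratic_ofReal_mul,
    weilSemilocalCross_ofReal_mul, Complex.re_ofReal_mul]

/-- `‖a v + b w‖₂² = a²‖v‖₂² + b²‖w‖₂²` for `v ⊥ w` and real `a, b`. -/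
theorem integral_norm_sq_combo (hv : IsWeilTest v) (hw : IsWeilTest w) (horth : ∫ t, v t * conj (w t) = 0) (a b : ℝ) :
    ∫ t, ‖(a : ℂ) * v t + (b : ℂ) * w t‖ ^ 2 = a ^ 2 * (∫ t, ‖v t‖ ^ 2) + b ^ 2 * ∫ t, ‖w t‖ ^ 2 := by
  have hv' := hv.const_mul a
  have hw' := hw.const_mul b
  have e : (fun t ↦ ‖(a : ℂ) * v t + (b : ℂ) * w t‖ ^ 2) =
      fun t ↦ (‖(a : ℂ) * v t‖ ^ 2 + ‖(b : ℂ) * w t‖ ^ 2) + 2 * ((a : ℂ) * v t * conj ((b : ℂ) * w t)).re := by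
    funext t
    rw [← Complex.normSq_eq_norm_sq, ← Complex.normSq_eq_norm_sq, ← Complex.normSq_eq_norm_sq, Complex.normSq_add]
  have i1 := hv'.integrable_norm_sq
  have i2 := hw'.integrable_norm_sq
  have i3 : Integrable fun t ↦ (a : ℂ) * v t * conj ((b : ℂ) * w t) :=
    hv'.integrable_mul (Complex.continuous_conj.comp hw'.1.continuous)
  have i12 : Integrable fun t ↦ ‖(a : ℂ) * v t‖ ^ 2 + ‖(b : ℂ) * w t‖ ^ 2 := i1.add i2
  have i3' : Integrable fun t ↦ 2 * ((a : ℂ) * v t * conj ((b : ℂ) * w t)).re := (i3.re).const_mul 2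
  have i4 : ∫ t, ((a : ℂ) * v t * conj ((b : ℂ) * w t)).re = (∫ t, (a : ℂ) * v t * conj ((b : ℂ) * w t)).re := by
    have := integral_re i3
    simpa only [RCLike.re_to_complex] using this
  -- `∫‖a f‖² = a²∫‖f‖²` (the tree's `OddSector.integral_norm_sq_real_mul`, inlined to keep the imports minimal)
  have hsc : ∀ (r : ℝ) (f : ℝ → ℂ), ∫ t, ‖(r : ℂ) * f t‖ ^ 2 = r ^ 2 * ∫ t, ‖f t‖ ^ 2 := fun r f ↦ by
    simp only [norm_mul, mul_pow, Complex.norm_real, Real.norm_eq_abs, sq_abs]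
    exact integral_const_mul _ _
  rw [e, integral_add i12 i3', integral_add i1 i2, integral_const_mul, i4, integral_ofReal_mul_mul_conj, horth, mul_zero,
    Complex.zero_re, mul_zero, add_zero, hsc a v, hsc b w]

/-- The support of a combination stays in the window. -/
theorem tsupport_combo_subset (hv : tsupport v ⊆ Icc (-c) c) (hw : tsupport w ⊆ Icc (-c) c) (a b : ℂ) :
    tsupport (fun t ↦ a * v t + b * w t) ⊆ Icc (-c) c :=
  (tsupport_add (fun t ↦ a * v t) (fun t ↦ b * w t)).trans
    (union_subset (tsupport_mul_subset_right.trans hv) (tsupport_mul_subset_right.trans hw))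

/-! ## §3  The two-level Ritz ceiling -/

/-- **TWO-LEVEL TRIAL FUNCTION.**  `v ⊥ w` test functions with `‖v‖₂, ‖w‖₂ ≠ 0`, quotients `Re Q_S(v) ≤ m₁‖v‖₂²`, `Re Q_S(w) ≤ m₂‖w‖₂²`
and cross form `Re C_S(v, w) ≤ −2β‖v‖₂‖w‖₂` with `β ≥ 0`: some combination `g = a v + b w` with `a, b ≥ 0` has `‖g‖₂ ≠ 0` and
`Re Q_S(g) ≤ λ₋(m₁, m₂, β)·‖g‖₂²`. -/
theorem exists_combo_re_le_twoLevel (S : Finset ℕ) (hv : IsWeilTest v) (hw : IsWeilTest w)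
    (horth : ∫ t, v t * conj (w t) = 0) (hv0 : 0 < ∫ t, ‖v t‖ ^ 2) (hw0 : 0 < ∫ t, ‖w t‖ ^ 2) (hβ : 0 ≤ β)
    (h₁ : (weilSemilocalQuadratic S v).re ≤ m₁ * ∫ t, ‖v t‖ ^ 2)
    (h₂ : (weilSemilocalQuadratic S w).re ≤ m₂ * ∫ t, ‖w t‖ ^ 2)
    (hC : (weilSemilocalFunctional S (weilConv v (weilReflect w)) + weilSemilocalFunctional S (weilConv w (weilReflect v))).re ≤
      -(2 * β * Real.sqrt (∫ t, ‖v t‖ ^ 2) * Real.sqrt (∫ t, ‖w t‖ ^ 2))) :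
    ∃ a b : ℝ, 0 ≤ a ∧ 0 ≤ b ∧ 0 < ∫ t, ‖(a : ℂ) * v t + (b : ℂ) * w t‖ ^ 2 ∧
      (weilSemilocalQuadratic S (fun t ↦ (a : ℂ) * v t + (b : ℂ) * w t)).re ≤
        ((m₁ + m₂) / 2 - Real.sqrt (((m₂ - m₁) / 2) ^ 2 + β ^ 2)) * ∫ t, ‖(a : ℂ) * v t + (b : ℂ) * w t‖ ^ 2 := by
  set l := (m₁ + m₂) / 2 - Real.sqrt (((m₂ - m₁) / 2) ^ 2 + β ^ 2) with hl
  have hl2 : l ≤ m₂ := by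
    -- `λ₋ ≤ m₂` (`SemilocalDeletionCompression.twoBlockFloor_le_right`, inlined: that module has no hub olean yet)
    have hs : |(m₂ - m₁) / 2| ≤ Real.sqrt (((m₂ - m₁) / 2) ^ 2 + β ^ 2) := Real.abs_le_sqrt (by nlinarith [sq_nonneg β])
    have := neg_abs_le ((m₂ - m₁) / 2)
    rw [hl]; linarith
  obtain ⟨A, hA0, hA2⟩ : ∃ A : ℝ, 0 < A ∧ A ^ 2 = ∫ t, ‖v t‖ ^ 2 := ⟨_, Real.sqrt_pos.2 hv0, Real.sq_sqrt hv0.le⟩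
  obtain ⟨B, hB0, hB2⟩ : ∃ B : ℝ, 0 < B ∧ B ^ 2 = ∫ t, ‖w t‖ ^ 2 := ⟨_, Real.sqrt_pos.2 hw0, Real.sq_sqrt hw0.le⟩
  have hsA : Real.sqrt (∫ t, ‖v t‖ ^ 2) = A := by rw [← hA2, Real.sqrt_sq hA0.le]
  have hsB : Real.sqrt (∫ t, ‖w t‖ ^ 2) = B := by rw [← hB2, Real.sqrt_sq hB0.le]
  rw [hsA, hsB] at hC
  rcases (sub_nonneg.2 hl2).eq_or_lt with h0 | hpos
  · -- degenerate bottom eigenvector: `l = m₂`; the block `w` alone does it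
    refine ⟨0, 1, le_rfl, zero_le_one, ?_, ?_⟩
    · rw [integral_norm_sq_combo hv hw horth]
      nlinarith [hv0, hw0]
    · rw [re_weilSemilocalQuadratic_combo S hv hw, integral_norm_sq_combo hv hw horth]
      have hlm : l = m₂ := by linarith
      rw [hlm]
      have e1 : m₂ * ((0 : ℝ) ^ 2 * (∫ t, ‖v t‖ ^ 2) + (1 : ℝ) ^ 2 * ∫ t, ‖w t‖ ^ 2) = m₂ * ∫ t, ‖w t‖ ^ 2 := by ring
      have e2 : (0 : ℝ) ^ 2 * (weilSemilocalQuadratic S v).re + (1 : ℝ) ^ 2 * (weilSemilocalQuadratic S w).re +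
          0 * 1 * (weilSemilocalFunctional S (weilConv v (weilReflect w)) + weilSemilocalFunctional S (weilConv w (weilReflect v))).re =
          (weilSemilocalQuadratic S w).re := by ring
      rw [e1, e2]
      exact h₂
  · -- generic: `(a‖v‖, b‖w‖) = (m₂ − l, β)`, the bottom eigenvector of `[[m₁, −β], [−β, m₂]]`
    refine ⟨(m₂ - l) / A, β / B, div_nonneg hpos.le hA0.le, div_nonneg hβ hB0.le, ?_, ?_⟩
    · rw [integral_norm_sq_combo hv hw horth, ← hA2, ← hB2]
      have : ((m₂ - l) / A) ^ 2 * A ^ 2 = (m₂ - l) ^ 2 := by field_simp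
      rw [this]
      nlinarith [sq_nonneg (β / B), sq_nonneg B, hpos]
    · rw [re_weilSemilocalQuadratic_combo S hv hw, integral_norm_sq_combo hv hw horth, ← hA2, ← hB2]
      rw [← hA2] at h₁
      rw [← hB2] at h₂
      have ea : ((m₂ - l) / A) ^ 2 * A ^ 2 = (m₂ - l) ^ 2 := by field_simp
      have eb : (β / B) ^ 2 * B ^ 2 = β ^ 2 := by field_simp
      have hval := twoLevel_value_eq m₁ m₂ β
      rw [← hl] at hval
      -- bound each of the three terms
      have t1 : ((m₂ - l) / A) ^ 2 * (weilSemilocalQuadratic S v).re ≤ ((m₂ - l) / A) ^ 2 * (m₁ * A ^ 2) :=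
        mul_le_mul_of_nonneg_left h₁ (sq_nonneg _)
      have t2 : (β / B) ^ 2 * (weilSemilocalQuadratic S w).re ≤ (β / B) ^ 2 * (m₂ * B ^ 2) :=
        mul_le_mul_of_nonneg_left h₂ (sq_nonneg _)
      have hab : 0 ≤ (m₂ - l) / A * (β / B) := mul_nonneg (div_nonneg hpos.le hA0.le) (div_nonneg hβ hB0.le)
      have t3 : (m₂ - l) / A * (β / B) *
          (weilSemilocalFunctional S (weilConv v (weilReflect w)) + weilSemilocalFunctional S (weilConv w (weilReflect v))).re ≤
          (m₂ - l) / A * (β / B) * (-(2 * β * A * B)) := mul_le_mul_of_nonneg_left hC hab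
      have e1 : ((m₂ - l) / A) ^ 2 * (m₁ * A ^ 2) = m₁ * (m₂ - l) ^ 2 := by field_simp
      have e3 : (m₂ - l) / A * (β / B) * (-(2 * β * A * B)) = -(2 * β * (m₂ - l) * β) := by field_simp
      have e2 : (β / B) ^ 2 * (m₂ * B ^ 2) = m₂ * β ^ 2 := by field_simp
      rw [e1] at t1
      rw [e2] at t2
      rw [e3] at t3
      rw [ea, eb]
      linarith [hval]

/-- **TWO-LEVEL RITZ CEILING.**  Under the hypotheses of `exists_combo_re_le_twoLevel` with `v`, `w` on the window `[−c, c]` and a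
constraint `P` stable under nonnegative real combinations of `v` and `w`: `λ_min(S; c; P) ≤ λ₋(m₁, m₂, β)`. -/
theorem semilocalGroundEnergy_le_twoLevel (hv : IsWeilTest v) (hw : IsWeilTest w) (hvs : tsupport v ⊆ Icc (-c) c)
    (hws : tsupport w ⊆ Icc (-c) c) (horth : ∫ t, v t * conj (w t) = 0) (hv0 : 0 < ∫ t, ‖v t‖ ^ 2) (hw0 : 0 < ∫ t, ‖w t‖ ^ 2)
    (hβ : 0 ≤ β) (hP : ∀ a b : ℝ, 0 ≤ a → 0 ≤ b → P fun t ↦ (a : ℂ) * v t + (b : ℂ) * w t)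
    (h₁ : (weilSemilocalQuadratic S v).re ≤ m₁ * ∫ t, ‖v t‖ ^ 2)
    (h₂ : (weilSemilocalQuadratic S w).re ≤ m₂ * ∫ t, ‖w t‖ ^ 2)
    (hC : (weilSemilocalFunctional S (weilConv v (weilReflect w)) + weilSemilocalFunctional S (weilConv w (weilReflect v))).re ≤
      -(2 * β * Real.sqrt (∫ t, ‖v t‖ ^ 2) * Real.sqrt (∫ t, ‖w t‖ ^ 2))) :
    semilocalGroundEnergy S P c ≤ ((m₁ + m₂) / 2 - Real.sqrt (((m₂ - m₁) / 2) ^ 2 + β ^ 2)) := by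
  obtain ⟨a, b, ha, hb, hg0, hg⟩ := exists_combo_re_le_twoLevel S hv hw horth hv0 hw0 hβ h₁ h₂ hC
  have hgt : IsWeilTest fun t ↦ (a : ℂ) * v t + (b : ℂ) * w t := (hv.const_mul a).add (hw.const_mul b)
  have hP' : ∀ r : ℝ, 0 < r → P fun t ↦ (r : ℂ) * ((a : ℂ) * v t + (b : ℂ) * w t) := by
    intro r hr
    have e : (fun t ↦ (r : ℂ) * ((a : ℂ) * v t + (b : ℂ) * w t)) = fun t ↦ ((r * a : ℝ) : ℂ) * v t + ((r * b : ℝ) : ℂ) * w t := by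
      funext t
      push_cast
      ring
    rw [e]
    exact hP _ _ (mul_nonneg hr.le ha) (mul_nonneg hr.le hb)
  have hR := semilocalGroundEnergy_mul_le_re (S := S) hgt (tsupport_combo_subset hvs hws a b) hP'
  by_contra hlt
  rw [not_le] at hlt
  have := mul_lt_mul_of_pos_right hlt hg0
  linarith

/-- **Explicit two-level ceiling**: under the same hypotheses with `m₂ > m₁`,
`λ_min(S; c; P) ≤ m₁ − β²/(m₂ − m₁ + β²/(m₂ − m₁))`.  With `v` = a compressed bottom vector (`m₁ = π`), `w` = the direction of its
residual (`β = r`, `m₂ = κ`): the compression DEFECT `π − λ_min` is AT LEAST `r²/(κ − π + r²/(κ − π))` (the two-level law's lower end). -/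
theorem semilocalGroundEnergy_le_sub_div (hv : IsWeilTest v) (hw : IsWeilTest w) (hvs : tsupport v ⊆ Icc (-c) c)
    (hws : tsupport w ⊆ Icc (-c) c) (horth : ∫ t, v t * conj (w t) = 0) (hv0 : 0 < ∫ t, ‖v t‖ ^ 2) (hw0 : 0 < ∫ t, ‖w t‖ ^ 2)
    (hβ : 0 ≤ β) (hm : m₁ < m₂) (hP : ∀ a b : ℝ, 0 ≤ a → 0 ≤ b → P fun t ↦ (a : ℂ) * v t + (b : ℂ) * w t)
    (h₁ : (weilSemilocalQuadratic S v).re ≤ m₁ * ∫ t, ‖v t‖ ^ 2)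
    (h₂ : (weilSemilocalQuadratic S w).re ≤ m₂ * ∫ t, ‖w t‖ ^ 2)
    (hC : (weilSemilocalFunctional S (weilConv v (weilReflect w)) + weilSemilocalFunctional S (weilConv w (weilReflect v))).re ≤
      -(2 * β * Real.sqrt (∫ t, ‖v t‖ ^ 2) * Real.sqrt (∫ t, ‖w t‖ ^ 2))) :
    semilocalGroundEnergy S P c ≤ m₁ - β ^ 2 / (m₂ - m₁ + β ^ 2 / (m₂ - m₁)) :=
  (semilocalGroundEnergy_le_twoLevel hv hw hvs hws horth hv0 hw0 hβ hP h₁ h₂ hC).trans (twoLevel_le_sub_div hm β)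

/-! ## §4  The dipole ceiling sharpened by a second level -/

variable {h u : ℝ → ℂ} {δ : ℝ} {p : ℕ}

/-- **TWO-LEVEL DIPOLE CEILING.**  `p ∈ S` prime, `h ∈ C(δ)` a block with `2δ < log p` and `‖h‖₂ ≠ 0`, `d_h` its antisymmetric dipole,
`D := Re Q_S(d_h)/‖d_h‖₂²` the UNDELETED dipole energy (so `Re Q_{S∖{p}}(d_h) = (D − log p/√p)‖d_h‖₂²`).  If a test function `u ⊥ d_h` on the
window `[−((log p)/2 + δ), (log p)/2 + δ]`, `‖u‖₂ ≠ 0`, has `Re Q_{S∖{p}}(u) ≤ (K − log p/√p)‖u‖₂²` and couples to the dipole,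
`Re C_{S∖{p}}(d_h, u) ≤ −2β‖d_h‖₂‖u‖₂` (`β ≥ 0`), and `P` is stable under nonnegative combinations of `d_h` and `u`, then
`λ_min(S∖{p}; (log p)/2 + δ; P) + log p/√p ≤ λ₋(D, K, β)` — below the dipole ceiling `D` by almost `β²/(K − D)`. -/
theorem semilocalGroundEnergy_erase_add_le_twoLevel_dipole (hh : IsWeilTest h) (hsupp : tsupport h ⊆ Icc (-δ) δ)
    (hp : p.Prime) (hpS : p ∈ S) (hδ : 2 * δ < Real.log p) (hh0 : 0 < ∫ t, ‖h t‖ ^ 2) {D K : ℝ}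
    (hD : D = (weilSemilocalQuadratic S (fun t ↦ h (t + Real.log p / 2) - h (t - Real.log p / 2))).re / (2 * ∫ t, ‖h t‖ ^ 2))
    (hu : IsWeilTest u) (hus : tsupport u ⊆ Icc (-(Real.log p / 2 + δ)) (Real.log p / 2 + δ)) (hu0 : 0 < ∫ t, ‖u t‖ ^ 2)
    (horth : ∫ t, (h (t + Real.log p / 2) - h (t - Real.log p / 2)) * conj (u t) = 0) (hβ : 0 ≤ β)
    (hK : (weilSemilocalQuadratic (S.erase p) u).re ≤ (K - Real.log p / Real.sqrt p) * ∫ t, ‖u t‖ ^ 2)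
    (hC : (weilSemilocalFunctional (S.erase p) (weilConv (fun t ↦ h (t + Real.log p / 2) - h (t - Real.log p / 2)) (weilReflect u)) +
        weilSemilocalFunctional (S.erase p) (weilConv u (weilReflect fun t ↦ h (t + Real.log p / 2) - h (t - Real.log p / 2)))).re ≤
      -(2 * β * Real.sqrt (∫ t, ‖h (t + Real.log p / 2) - h (t - Real.log p / 2)‖ ^ 2) * Real.sqrt (∫ t, ‖u t‖ ^ 2)))
    (hP : ∀ a b : ℝ, 0 ≤ a → 0 ≤ b → P fun t ↦ (a : ℂ) * (h (t + Real.log p / 2) - h (t - Real.log p / 2)) + (b : ℂ) * u t) :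
    semilocalGroundEnergy (S.erase p) P (Real.log p / 2 + δ) + Real.log p / Real.sqrt p ≤
      ((D + K) / 2 - Real.sqrt (((K - D) / 2) ^ 2 + β ^ 2)) := by
  have hL := log_prime_pos hp
  have hd := isWeilTest_dipole hh (Real.log p)
  have hds := tsupport_dipole_subset hsupp hL.le (L := Real.log p)
  have hd0 : 0 < ∫ t, ‖h (t + Real.log p / 2) - h (t - Real.log p / 2)‖ ^ 2 := by
    rw [integral_norm_sq_dipole hh hsupp hδ]; positivity
  have hDN : D * (2 * ∫ t, ‖h t‖ ^ 2) =
      (weilSemilocalQuadratic S (fun t ↦ h (t + Real.log p / 2) - h (t - Real.log p / 2))).re := by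
    have h2 : (∫ t, ‖h t‖ ^ 2) ≠ 0 := hh0.ne'
    rw [hD]
    generalize (weilSemilocalQuadratic S (fun t ↦ h (t + Real.log p / 2) - h (t - Real.log p / 2))).re = Q
    field_simp
  have h₁ : (weilSemilocalQuadratic (S.erase p) (fun t ↦ h (t + Real.log p / 2) - h (t - Real.log p / 2))).re ≤
      (D - Real.log p / Real.sqrt p) * ∫ t, ‖h (t + Real.log p / 2) - h (t - Real.log p / 2)‖ ^ 2 := by
    rw [re_weilSemilocalQuadratic_erase_dipole hh hsupp hp hpS hδ, integral_norm_sq_dipole hh hsupp hδ, sub_mul, hDN]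
  have hmain := semilocalGroundEnergy_le_twoLevel (S := S.erase p) (P := P) (m₁ := D - Real.log p / Real.sqrt p)
    (m₂ := K - Real.log p / Real.sqrt p) hd hu hds hus horth hd0 hu0 hβ hP h₁ hK hC
  rw [show (K - Real.log p / Real.sqrt p) - (D - Real.log p / Real.sqrt p) = K - D by ring] at hmain
  linarith

end Summit.RiemannHypothesis.RiemannHypothesis.Theorems.SemilocalDeletionCompressionCeiling
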